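import Mathlib
import Summits.NavierStokesRegularity.NavierStokesRegularity.Theorems.EulerZoomLiouvillePowerGaugeEulerLiouvilleSelfSimilarTopBadNodeHyperbolic
import Summits.NavierStokesRegularity.NavierStokesRegularity.Theorems.EulerZoomLiouvillePowerGaugeEulerLiouvilleSelfSimilarCountableNodalSet
import Summits.NavierStokesRegularity.NavierStokesRegularity.Theorems.EulerZoomLiouvillePowerGaugeEulerLiouvilleSelfSimilarFiniteHyperbolicFarField
import HarnessLib.Audit

/-!
# Rung C1 of the crux `EulerZoomLiouville.PowerGaugeEulerLiouville`: the classical portrait after the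
# nodal-continuum line, and its member-level stratum of `stub_selfSimilarExtremalRest`

Route №10 `EulerZoomLiouville` (NavierStokesRegularity), crux E = stmt-NavierStokesRegularity-19832,
tenure rung C1 (exactly self-similar members), registered residue `stub_selfSimilarExtremal(Rest)`.
Sixth file of the NODAL-CONTINUUM line (lineage ns-typeII-p1, gen 7): bookkeeping corollaries combining
`eq_zero_of_badNodes_nondegenerate` / `exists_degenerate_topBadNode_of_ne_zero`
(`…SelfSimilarTopBadNodeHyperbolic`, no hypothesis on the nodal set) with the nodal-countability exclusion
`not_countable_selfSimilarNodalSet_of_ne_zero` (lineage ns-typeII-p2, `…SelfSimilarCountableNodalSet`):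

* `portrait_of_ne_zero` — **a NONTRIVIAL `C²` in-window profile with (3.8) has an UNCOUNTABLE stagnation
  set AND a degenerate top bad node**: a non-vortical stagnation point `z♭ ∈ ∂{Ω ≠ 0}` with a unit
  stretching rate `≥ 1`, `−γ ∈ spec DU(z♭)`, and `{Ω ≠ 0} ⊆ {ℋ < ℋ(z♭)}`;
* `selfSimilar_ae_eq_zero_of_badNodes_nondegenerate` — MEMBER LEVEL (binder shape of the lineage's
  strata, `u(τ) = selfSimilarCollapse (1/(2+ρ)) 0 V τ`, any `ρ > 0`): an exactly self-similar field whose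
  classical profile has (3.8) and NONDEGENERATE bad non-vortical stagnation points vanishes a.e. on
  `(−∞,0) × ℝ³` — an UNCONDITIONAL stratum of `stub_selfSimilarExtremalRest` (no Robinson fact, no
  finiteness / genericity of the stagnation set; compare `selfSimilar_ae_eq_zero_of_finite_nodalSet`).

WHAT THIS IS NOT: not NS, not E, not the stub — classical (`C²`) profiles with (3.8); degenerate top bad
nodes (stagnation curves/circles through a strongly strained non-vortical point) and the weak class are
untouched.  References: P. Constantin, M. Ignatova, V. Vicol, arXiv:2602.17570 (2026), §3.5, §4.
[ConstantinIgnatovaVicol2026Putative]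
-/

noncomputable section

-- flat `Theorems/<Route><Decl>…` files of one crux share the namespace of the crux (tree convention)
set_option linter.dupNamespace false

open MeasureTheory Set Filter Topology Metric Function InnerProductSpace
open scoped RealInnerProductSpace NNReal ContDiff

namespace Summit.NavierStokesRegularity.NavierStokesRegularity.Theorems.PowerGaugeEulerLiouville.NodalContinuum

open Literature.Analysis Literature.Analysis.FluidPDE
open Summit.NavierStokesRegularity.NavierStokesRegularity.Theorems.PowerGaugeEulerLiouville.NodalFiniteness
open Summit.NavierStokesRegularity.NavierStokesRegularity.Theorems.PowerGaugeEulerLiouville.Kelvin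

variable {γ C : ℝ} {c : EuclideanSpace ℝ (Fin 3)}
  {U : EuclideanSpace ℝ (Fin 3) → EuclideanSpace ℝ (Fin 3)} {P : EuclideanSpace ℝ (Fin 3) → ℝ}

/-- **THE CLASSICAL PORTRAIT (rung C1) after the nodal-finiteness and nodal-continuum lines.**  Let
`0 < γ < ½` and let `(U, P)` be a NONTRIVIAL `C²` self-similar Euler profile (CIV (3.3)) with the far-field
bounds (3.8).  Then (i) the stagnation set of `V = γ(y−c) + U` is UNCOUNTABLE, and (ii) there is a
stagnation point `z♭` with `curl U(z♭) = 0`, a unit `w` with `⟪DU(z♭)w, w⟫ ≥ 1`, a vector `v ≠ 0` with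
`DU(z♭)v = −γv`, `z♭ ∈ closure{curl U ≠ 0}`, and `ℋ < ℋ(z♭)` on `{curl U ≠ 0}`.
[cite: ConstantinIgnatovaVicol2026Putative, §3.5 Thms 3.8–3.10, §4 (portrait not in print)] -/
theorem portrait_of_ne_zero (h : IsSelfSimilarEulerProfile γ c U P) (hγ : 0 < γ) (hγ2 : γ < 1 / 2)
    (hfar : HasSelfSimilarFarFieldWith γ c C U) (hU : U ≠ 0) :
    ¬ (selfSimilarNodalSet γ c U).Countable ∧
      ∃ z ∈ selfSimilarNodalSet γ c U, curl U z = 0 ∧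
        (∃ w : EuclideanSpace ℝ (Fin 3), ‖w‖ = 1 ∧ 1 ≤ ⟪fderiv ℝ U z w, w⟫) ∧
        z ∈ closure {y | curl U y ≠ 0} ∧
        (∀ x, curl U x ≠ 0 → selfSimilarBernoulli γ c U P x < selfSimilarBernoulli γ c U P z) ∧
        ∃ v : EuclideanSpace ℝ (Fin 3), v ≠ 0 ∧ fderiv ℝ U z v = (-γ) • v :=
  ⟨not_countable_selfSimilarNodalSet_of_ne_zero h hγ hγ2 hfar hU,
    exists_degenerate_topBadNode_of_ne_zero h hγ hγ2 hfar hU⟩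

/-- **MEMBER LEVEL — an unconditional stratum of `stub_selfSimilarExtremalRest`** (any `ρ > 0`,
`γ = 1/(2+ρ)`): an exactly self-similar field `u(τ) = selfSimilarCollapse (1/(2+ρ)) 0 V τ` (`τ < 0`) whose
classical profile (`IsSelfSimilarEulerProfile (1/(2+ρ)) 0 V P`) has the far-field bounds (3.8) and whose
NON-VORTICAL stagnation points with a stretching rate `≥ 1` all have injective linearisation
`(2+ρ)⁻¹ I + DV(z)`, vanishes a.e. on `(−∞,0) × ℝ³`.  No finiteness or countability of the stagnation set,
no named fact. [cite: ConstantinIgnatovaVicol2026Putative, §3.5 Thm 3.10 (nodal hypotheses replaced by nondegeneracy of bad non-vortical nodes; not in print)] -/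
theorem selfSimilar_ae_eq_zero_of_badNodes_nondegenerate {ρ : ℝ} (hρ : 0 < ρ)
    {V : EuclideanSpace ℝ (Fin 3) → EuclideanSpace ℝ (Fin 3)} {P : EuclideanSpace ℝ (Fin 3) → ℝ}
    (u : ℝ → EuclideanSpace ℝ (Fin 3) → EuclideanSpace ℝ (Fin 3))
    (hu : ∀ τ : ℝ, τ < 0 → u τ = selfSimilarCollapse (1 / (2 + ρ)) 0 V τ)
    (hprof : IsSelfSimilarEulerProfile (1 / (2 + ρ)) 0 V P)
    (hfar : HasSelfSimilarFarField (1 / (2 + ρ)) 0 V)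
    (hnd : ∀ z ∈ selfSimilarNodalSet (1 / (2 + ρ)) 0 V, curl V z = 0 →
      (∃ w : EuclideanSpace ℝ (Fin 3), ‖w‖ = 1 ∧ 1 ≤ ⟪fderiv ℝ V z w, w⟫) →
      ∀ v, fderiv ℝ (selfSimilarTransport (1 / (2 + ρ)) 0 V) z v = 0 → v = 0) :
    uncurry u =ᵐ[volume.restrict (Iio (0 : ℝ) ×ˢ (univ : Set (EuclideanSpace ℝ (Fin 3))))] 0 := by
  obtain ⟨C, hC⟩ := hfar
  exact selfSimilar_ae_eq_zero_of_profile_eq_zero u hu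
    (eq_zero_of_badNodes_nondegenerate_of_exponent hρ hprof hC hnd)

end Summit.NavierStokesRegularity.NavierStokesRegularity.Theorems.PowerGaugeEulerLiouville.NodalContinuum
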